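import Summits.HodgeConjecture.HodgeConjecture.Theorems.K2E3UnitaryParabolicLeviPart
import Literature.NumberTheory.Automorphic.GLnStandardLeviUnimodular
import HarnessLib

/-!
# K2 ∕ E3 «EllipticInputs», 13a road A, J4 (ii)-top (continued): the Witt parabolics and Levis of a unitary group are CLOSED and the
# Levi projection is CONTINUOUS (the DRIVER's binders `hP`, `hM`, `hproj`)

Cell `hodgecm-mathlib` (Track B «K2-LIT»), item h413 = `stmt-HodgeConjecture-24833`; author K2E3-p10 (g2); count-neutral helper for the 13a
line (road A; DRIVER ★ `K2E3LocalIrrepAdmissibleOfConeInputs.localIrrepAdmissible_of_cuspidalDichotomy`, binders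
`(∀ i, IsClosed (t i).P) ∧ (∀ i, IsClosed (t i).M) ∧ (∀ i, Continuous (t i).proj)`).  PROOF lane: theorems only (no `def`, no
`instance`, no `sorry`), in the def-free COMAP currency of ★ `K2E3UnitaryParabolicLeviPart` — K2-defs1's
`wittParabolic ∕ wittLevi ∕ wittRadical σ J e S` ARE these comaps (`(standardParabolicGL ∕ standardLeviGL ∕ unipotentRadicalGL R c).comap U.subtype`
with `c = wittBlockOn e S`), so every statement below applies to `standardParabolicTriple σ e Han S` with `rfl` side conditions.

* §1 `isClosed_comap_standardParabolicGL`, `isClosed_comap_standardLeviGL` (any `T₂` topological ring).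
* §2 **`coe_proj_eq_leviPart`** — for ANY `ParabolicTriple t` of `↥U(σ, J)` whose `P, M, N` are the three comaps (anti-block `J`): the abstract Levi
  projection `t.proj` (defined by `M ⋉ N`-uniqueness) IS the block-diagonal part `leviEmbeddingP R c (leviProjection R c p)`.
* §3 **`continuous_proj_of_eq`** — hence `t.proj` is continuous (entries of the block-diagonal part and of its inverse are entries of `p`, `p⁻¹`).

References: I. N. Bernstein, A. V. Zelevinsky, *Induced representations of reductive p-adic groups I* (1977), §1.8, §2.1; W. Casselman, *Introduction to
the theory of admissible representations of p-adic reductive groups* (1995), §1.4.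
-/

set_option autoImplicit false
set_option linter.dupNamespace false

noncomputable section

namespace Summit.HodgeConjecture.HodgeConjecture.Cruxes.H413.K2E3UnitaryParabolicTopology

open Literature.NumberTheory.Automorphic K2E3UnitaryParabolicLeviPart
open scoped Matrix MatrixGroups Topology

variable {R : Type*} [CommRing R] [TopologicalSpace R] [IsTopologicalRing R] [T2Space R] (σ : R →+* R)
  {n : Type*} [Fintype n] [DecidableEq n] {α : Type*} [LinearOrder α] [Fintype α] (c : n → α) (J : Matrix n n R)

/-! ## §1 Closedness -/

omit [IsTopologicalRing R] [Fintype α] in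
/-- `P_c ∩ U` is closed in `↥U`. [cite: BernsteinZelevinsky1977, §2.1] -/
theorem isClosed_comap_standardParabolicGL :
    IsClosed (((standardParabolicGL R c).comap (unitaryGroupOfForm σ J).subtype : Subgroup ↥(unitaryGroupOfForm σ J)) :
      Set ↥(unitaryGroupOfForm σ J)) :=
  ((isClosed_setOf_blockTriangular (b := c)).preimage Units.continuous_val).preimage continuous_subtype_val

omit [IsTopologicalRing R] in
/-- `M_c ∩ U` is closed in `↥U`. [cite: BernsteinZelevinsky1977, §2.1] -/
theorem isClosed_comap_standardLeviGL :
    IsClosed (((standardLeviGL R c).comap (unitaryGroupOfForm σ J).subtype : Subgroup ↥(unitaryGroupOfForm σ J)) :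
      Set ↥(unitaryGroupOfForm σ J)) :=
  (isClosed_standardLeviGL (R := R) c).preimage continuous_subtype_val

/-! ## §2 The abstract Levi projection is the block-diagonal part -/

omit [TopologicalSpace R] [IsTopologicalRing R] [T2Space R] in
/-- **`t.proj p` is the block-diagonal part of `p`**, for any parabolic triple `t` of `↥U(σ, J)` with `t.M = M_c ∩ U`, `t.N = U_c ∩ U`
and `p ∈ P_c` (uniqueness of the `M_c ⋉ U_c` decomposition inside `P_c ≤ GL_n`, ★ `parabolicTripleGL`; no condition on `J`).
[cite: BernsteinZelevinsky1977, §1.8] -/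
theorem coe_proj_eq_leviPart (t : ParabolicTriple ↥(unitaryGroupOfForm σ J))
    (hM : t.M = (standardLeviGL R c).comap (unitaryGroupOfForm σ J).subtype)
    (hN : t.N = (unipotentRadicalGL R c).comap (unitaryGroupOfForm σ J).subtype) (p : ↥t.P)
    (hpP : ((p : ↥(unitaryGroupOfForm σ J)) : GL n R) ∈ standardParabolicGL R c) :
    ((t.proj p : ↥(unitaryGroupOfForm σ J)) : GL n R) =
      (leviEmbeddingP R c (leviProjection R c ⟨((p : ↥(unitaryGroupOfForm σ J)) : GL n R), hpP⟩) : GL n R) := by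
  set q : ↥(standardParabolicGL R c) := ⟨((p : ↥(unitaryGroupOfForm σ J)) : GL n R), hpP⟩ with hqdef
  set ℓ := leviEmbeddingP R c (leviProjection R c q) with hℓdef
  set x : ↥t.M := t.proj p with hxdef
  -- `x ∈ M_c`, `x⁻¹ p ∈ U_c`
  have hxM : ((x : ↥(unitaryGroupOfForm σ J)) : GL n R) ∈ standardLeviGL R c :=
    Subgroup.mem_comap.1 (hM.le x.2)
  have hxN : ((x : ↥(unitaryGroupOfForm σ J)) : GL n R)⁻¹ * ((p : ↥(unitaryGroupOfForm σ J)) : GL n R) ∈ unipotentRadicalGL R c := by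
    have h' := Subgroup.mem_comap.1 (hN.le (t.proj_inv_mul_mem p))
    rwa [Subgroup.coe_subtype, Subgroup.coe_mul, Subgroup.coe_inv] at h'
  -- `ℓ ∈ M_c`, `ℓ⁻¹ q ∈ U_c`
  have hℓM : (ℓ : GL n R) ∈ standardLeviGL R c := ⟨_, rfl⟩
  have hℓN : ((ℓ⁻¹ * q : ↥(standardParabolicGL R c)) : GL n R) ∈ unipotentRadicalGL R c := by
    have hker : ℓ⁻¹ * q ∈ unipotentRadicalP R c := by
      rw [MonoidHom.mem_ker, map_mul, map_inv, hℓdef, leviProjection_leviEmbeddingP_apply, inv_mul_cancel]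
    rw [← unipotentRadicalGL_subgroupOf] at hker
    exact Subgroup.mem_subgroupOf.1 hker
  -- `y := ℓ⁻¹ x ∈ M_c ∩ U_c` inside `P_c`, hence `y = 1`
  have hxP : ((x : ↥(unitaryGroupOfForm σ J)) : GL n R) ∈ standardParabolicGL R c := standardLeviGL_le R c hxM
  set y : ↥(standardParabolicGL R c) := ℓ⁻¹ * ⟨((x : ↥(unitaryGroupOfForm σ J)) : GL n R), hxP⟩ with hydef
  have hyM : y ∈ (standardLeviGL R c).subgroupOf (standardParabolicGL R c) := by
    rw [Subgroup.mem_subgroupOf]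
    exact (standardLeviGL R c).mul_mem ((standardLeviGL R c).inv_mem hℓM) hxM
  have hyN : y ∈ (unipotentRadicalGL R c).subgroupOf (standardParabolicGL R c) := by
    rw [Subgroup.mem_subgroupOf]
    -- `ℓ⁻¹ x = (ℓ⁻¹ p) (x⁻¹ p)⁻¹`
    have hcalc : ((y : ↥(standardParabolicGL R c)) : GL n R) =
        ((ℓ⁻¹ * q : ↥(standardParabolicGL R c)) : GL n R) * ((((x : ↥(unitaryGroupOfForm σ J)) : GL n R)⁻¹ * ((p : ↥(unitaryGroupOfForm σ J)) : GL n R)))⁻¹ := by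
      rw [hydef, hqdef, Subgroup.coe_mul, Subgroup.coe_mul, Subgroup.coe_inv, _root_.mul_inv_rev, inv_inv]
      simp only [mul_assoc, mul_inv_cancel_left]
    rw [hcalc]
    exact (unipotentRadicalGL R c).mul_mem hℓN ((unipotentRadicalGL R c).inv_mem hxN)
  have hdis := (parabolicTripleGL R c).isComplement'.disjoint
  rw [Subgroup.disjoint_def] at hdis
  have hy1 : y = 1 := hdis hyM hyN
  have hy1' : (ℓ : GL n R)⁻¹ * ((x : ↥(unitaryGroupOfForm σ J)) : GL n R) = 1 := by
    have := congrArg (fun z : ↥(standardParabolicGL R c) => (z : GL n R)) hy1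
    simpa [hydef] using this
  exact (inv_mul_eq_one.1 hy1').symm

/-! ## §3 Continuity of the Levi projection -/

omit [IsTopologicalRing R] [T2Space R] [Fintype n] [DecidableEq n] [Fintype α] in
/-- The block-diagonal-part matrix `[c i = c j] · p_{ij}` depends continuously on `p`. [folklore] -/
theorem continuous_blockDiag_matrix {X : Type*} [TopologicalSpace X] (f : X → Matrix n n R) (hf : Continuous f) :
    Continuous fun x => Matrix.of fun i j => if c i = c j then f x i j else 0 := by
  refine continuous_matrix fun i j => ?_
  by_cases h : c i = c j
  · simp only [Matrix.of_apply, if_pos h]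
    exact hf.matrix_elem i j
  · simp only [Matrix.of_apply, if_neg h]
    exact continuous_const

omit [T2Space R] in
/-- **The Levi projection of a Witt parabolic of `U(σ, J)` is continuous**, for any parabolic triple `t` of `↥U(σ, J)` whose `P, M, N` are the
comaps of `P_c, M_c, U_c` and `J` anti-block: `t.proj p` is the block-diagonal part of `p` (§2), whose entries — and those of its inverse, the
block-diagonal part of `p⁻¹` — are entries of `p`, `p⁻¹`. [cite: BernsteinZelevinsky1977, §1.8] [cite: Casselman1995, §1.4] -/
theorem continuous_proj_of_eq (τ : α → α) (hτ : ∀ a b, a ≤ b → τ b ≤ τ a) (hτi : Function.Injective τ)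
    (hJ : ∀ k l, J k l ≠ 0 → c l = τ (c k)) (t : ParabolicTriple ↥(unitaryGroupOfForm σ J))
    (hP : t.P = (standardParabolicGL R c).comap (unitaryGroupOfForm σ J).subtype)
    (hM : t.M = (standardLeviGL R c).comap (unitaryGroupOfForm σ J).subtype)
    (hN : t.N = (unipotentRadicalGL R c).comap (unitaryGroupOfForm σ J).subtype) :
    Continuous t.proj := by
  have hpP : ∀ p : ↥t.P, ((p : ↥(unitaryGroupOfForm σ J)) : GL n R) ∈ standardParabolicGL R c := fun p =>
    Subgroup.mem_comap.1 (hP.le p.2)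
  -- the block-diagonal part as a homomorphism `t.P →* GL n R`
  let qHom : ↥t.P →* ↥(standardParabolicGL R c) := ((unitaryGroupOfForm σ J).subtype.comp t.P.subtype).codRestrict _ hpP
  let ℓ : ↥t.P →* GL n R :=
    (standardParabolicGL R c).subtype.comp (((leviEmbeddingP R c).comp (leviProjection R c)).comp qHom)
  have hℓ : ∀ p : ↥t.P, ℓ p = (leviEmbeddingP R c (leviProjection R c ⟨((p : ↥(unitaryGroupOfForm σ J)) : GL n R), hpP p⟩) : GL n R) := fun p => rfl
  have hℓU : ∀ p : ↥t.P, ℓ p ∈ unitaryGroupOfForm σ J := fun p =>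
    leviPart_mem_unitaryGroupOfForm σ c τ hτ hτi J hJ ⟨((p : ↥(unitaryGroupOfForm σ J)) : GL n R), hpP p⟩ (p : ↥(unitaryGroupOfForm σ J)).2
  have hℓM : ∀ p : ↥t.P, (⟨ℓ p, hℓU p⟩ : ↥(unitaryGroupOfForm σ J)) ∈ t.M := fun p =>
    hM.symm.le (Subgroup.mem_comap.2 ⟨_, rfl⟩)
  -- `t.proj` is this map
  have hproj : (t.proj : ↥t.P → ↥t.M) = fun p => ⟨⟨ℓ p, hℓU p⟩, hℓM p⟩ := by
    funext p
    apply Subtype.ext; apply Subtype.ext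
    exact coe_proj_eq_leviPart σ c J t hM hN p (hpP p)
  -- entries of `ℓ p` and of `(ℓ p)⁻¹ = ℓ p⁻¹`
  have hval : ∀ p : ↥t.P, ((ℓ p : GL n R) : Matrix n n R) =
      Matrix.of fun i j => if c i = c j then (((p : ↥(unitaryGroupOfForm σ J)) : GL n R) : Matrix n n R) i j else 0 := fun p =>
    Matrix.ext fun i j => by rw [hℓ, coe_leviPart_apply, Matrix.of_apply]
  have hentry : Continuous fun p : ↥t.P => (((p : ↥(unitaryGroupOfForm σ J)) : GL n R) : Matrix n n R) :=
    Units.continuous_val.comp (continuous_subtype_val.comp continuous_subtype_val)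
  have hc1 : Continuous fun p : ↥t.P => ((ℓ p : GL n R) : Matrix n n R) := by
    simp only [hval]
    exact continuous_blockDiag_matrix c _ hentry
  have hc2 : Continuous fun p : ↥t.P => (((ℓ p)⁻¹ : GL n R) : Matrix n n R) := by
    have h : (fun p : ↥t.P => (((ℓ p)⁻¹ : GL n R) : Matrix n n R)) = fun p => ((ℓ p⁻¹ : GL n R) : Matrix n n R) := by
      funext p; rw [map_inv]
    rw [h]
    simp only [hval]
    exact continuous_blockDiag_matrix c _ (hentry.comp continuous_inv)
  have hℓc : Continuous fun p : ↥t.P => (ℓ p : GL n R) := Units.continuous_iff.2 ⟨hc1, hc2⟩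
  rw [hproj]
  exact (hℓc.subtype_mk _).subtype_mk _

end Summit.HodgeConjecture.HodgeConjecture.Cruxes.H413.K2E3UnitaryParabolicTopology

end
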